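import Summits.KontsevichZagierPeriods.KontsevichZagierPeriods.Theorems.SoloInformedTameEquidecompFamilies
import HarnessLib

/-!
# SoloInformed — nonlinear tame dissections as `ℚ`-semialgebraic families
# (the clauses without the derivative)

Solo programme `solo-KontsevichZagierPeriods-informed`, session s138, first file of the
NONLINEAR form of COROLLARY SQ (VERDICT §4, `real-parameters.md`): tame circle squaring is
impossible even with nonlinear `ℝ`-semialgebraic maps of Jacobian `±1`.  Files 495–498 treated
equi-affine maps; here the moving maps are arbitrary functions with `ℝ`-semialgebraic GRAPH,
injective on their piece and differentiable WITHIN the piece with `det² = 1`.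

A NONLINEAR SHAPE (`SoloInformedTameMapShape K n N`) over a finite real-parameter index `K`
consists of `N` `ℚ`-semialgebraic families of pieces `S i ⊆ ℝ^{K ⊕ n}`, `N` `ℚ`-semialgebraic
families of graphs `G i ⊆ ℝ^{K ⊕ (n ⊕ n)}` and `n` rational polynomials (the sides of the target
box).  This file records the clauses of validity that involve no derivative — the pieces
partition the source, the graphs are functional on the pieces, map them into the box, onto the
box, injectively and disjointly — each as ONE or TWO real quantifier blocks in front of a
`ℚ`-semialgebraic matrix, and proves each clause `ℚ`-semialgebraic in the parameter.  General
tools: universal / existential real quantifier BLOCKS over arbitrary finite index types preserve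
`k`-semialgebraicity (`soloInformed_isSemialgebraic_setOf_forall_block`, `…_exists_block`),
coordinate atoms.

References: Bochnak–Coste–Roy (1998) §2.2 (Tarski–Seidenberg); Basu–Pollack–Roy (2006) §2.5.
-/

noncomputable section

namespace Summit.KontsevichZagierPeriods.KontsevichZagierPeriods.Theorems

open Set MvPolynomial Literature.ModelTheory.ExponentialFields
open Literature.NumberTheory.Transcendental

section Blocks

variable {k : Type*} [CommRing k] [Algebra k ℝ]

/-- **A universal real quantifier block over any finite index type preserves
`k`-semialgebraicity.** [cite: BochnakCosteRoy1998, Prop. 2.2.4] -/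
theorem soloInformed_isSemialgebraic_setOf_forall_block {α β : Type*} [Finite α] [Finite β]
    {T : Set (α ⊕ β → ℝ)} (hT : IsSemialgebraic k T) {Φ : (α → ℝ) → Prop}
    (h : ∀ u, Φ u ↔ ∀ z : β → ℝ, Sum.elim u z ∈ T) : IsSemialgebraic k {u : α → ℝ | Φ u} := by
  have hset : {u : α → ℝ | Φ u} = {u | ∀ z : β → ℝ, Sum.elim u z ∈ T} := by
    ext u
    simp only [mem_setOf_eq, h]
  rw [hset, soloInformed_setOf_forall_sumElim_mem]
  exact (soloInformed_isSemialgebraic_image_comp_of_finite Sum.inl hT.compl).compl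

/-- `{u | ∃ z, (u, z) ∈ T}` is the coordinate projection of `T`. [folklore] -/
theorem soloInformed_setOf_exists_sumElim_mem {α β : Type*} (T : Set (α ⊕ β → ℝ)) :
    {u : α → ℝ | ∃ z : β → ℝ, Sum.elim u z ∈ T} = (fun w : α ⊕ β → ℝ => w ∘ Sum.inl) '' T := by
  ext u
  constructor
  · rintro ⟨z, hz⟩
    exact ⟨Sum.elim u z, hz, Sum.elim_comp_inl u z⟩
  · rintro ⟨w, hw, hwu⟩
    refine ⟨w ∘ Sum.inr, ?_⟩
    have hw' : Sum.elim u (w ∘ Sum.inr) = w := by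
      rw [← hwu]
      exact Sum.elim_comp_inl_inr w
    rw [hw']
    exact hw

/-- **An existential real quantifier block over any finite index type preserves
`k`-semialgebraicity** (Tarski–Seidenberg projection). [cite: BochnakCosteRoy1998, Prop. 2.2.1] -/
theorem soloInformed_isSemialgebraic_setOf_exists_block {α β : Type*} [Finite α] [Finite β]
    {T : Set (α ⊕ β → ℝ)} (hT : IsSemialgebraic k T) {Φ : (α → ℝ) → Prop}
    (h : ∀ u, Φ u ↔ ∃ z : β → ℝ, Sum.elim u z ∈ T) : IsSemialgebraic k {u : α → ℝ | Φ u} := by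
  have hset : {u : α → ℝ | Φ u} = {u | ∃ z : β → ℝ, Sum.elim u z ∈ T} := by
    ext u
    simp only [mem_setOf_eq, h]
  rw [hset, soloInformed_setOf_exists_sumElim_mem]
  exact soloInformed_isSemialgebraic_image_comp_of_finite Sum.inl hT

/-- Coordinate atom `w a - w b < w c`. [folklore] -/
theorem soloInformed_isSemialgebraic_setOf_coord_sub_lt {ι : Type*} (a b c : ι) :
    IsSemialgebraic ℚ {w : ι → ℝ | w a - w b < w c} := by
  have hset : {w : ι → ℝ | w a - w b < w c} =
      {w | aeval w (X a - X b : MvPolynomial ι ℚ) < aeval w (X c : MvPolynomial ι ℚ)} := by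
    ext w
    simp only [mem_setOf_eq, map_sub, aeval_X]
  rw [hset]
  exact isSemialgebraic_setOf_eval_lt _ _

/-- Coordinate atom `w a = w b`. [folklore] -/
theorem soloInformed_isSemialgebraic_setOf_coord_eq {ι : Type*} (a b : ι) :
    IsSemialgebraic ℚ {w : ι → ℝ | w a = w b} := by
  have hset : {w : ι → ℝ | w a = w b} = {w | aeval w (X a - X b : MvPolynomial ι ℚ) = 0} := by
    ext w
    simp only [mem_setOf_eq, map_sub, aeval_X, sub_eq_zero]
  rw [hset]
  exact isSemialgebraic_setOf_eval_eq_zero _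

/-- Coordinate atom `0 < w a`. [folklore] -/
theorem soloInformed_isSemialgebraic_setOf_coord_pos {ι : Type*} (a : ι) :
    IsSemialgebraic ℚ {w : ι → ℝ | 0 < w a} := by
  have hset : {w : ι → ℝ | 0 < w a} = {w | 0 < aeval w (X a : MvPolynomial ι ℚ)} := by
    ext w
    simp only [mem_setOf_eq, aeval_X]
  rw [hset]
  exact isSemialgebraic_setOf_eval_pos _

/-- Box atom at arbitrary addresses: `w ∘ ρY ∈ ∏_j [0, a_j(w ∘ ρP)]` for sides given by rational
polynomials in the parameter block. [folklore] -/
theorem soloInformed_isSemialgebraic_setOf_comp_mem_box {ι K : Type*} {n : ℕ} (ρP : K → ι)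
    (ρY : Fin n → ι) (Pa : Fin n → MvPolynomial K ℚ) :
    IsSemialgebraic ℚ {w : ι → ℝ |
      w ∘ ρY ∈ soloInformedTameBox (fun j => aeval (w ∘ ρP) (Pa j))} := by
  have hset : {w : ι → ℝ | w ∘ ρY ∈ soloInformedTameBox (fun j => aeval (w ∘ ρP) (Pa j))} =
      {w | ∀ j, 0 ≤ aeval w (X (ρY j) : MvPolynomial ι ℚ) ∧
        aeval w (X (ρY j) : MvPolynomial ι ℚ) ≤ aeval w (rename ρP (Pa j))} := by
    ext w
    simp only [soloInformedTameBox, mem_setOf_eq, mem_univ_pi, mem_Icc, Function.comp_apply,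
      aeval_X, aeval_rename]
  rw [hset]
  exact soloInformed_isSemialgebraic_setOf_forall fun j =>
    soloInformed_isSemialgebraic_setOf_and (isSemialgebraic_setOf_eval_nonneg _)
      (isSemialgebraic_setOf_eval_le _ _)

end Blocks

/-- A **nonlinear tame shape** with real-parameter index `K`, ambient dimension `n`, `N` pieces:
`ℚ`-semialgebraic families of pieces `S i ⊆ ℝ^{K ⊕ n}` and of graphs `G i ⊆ ℝ^{K ⊕ (n ⊕ n)}`
(parameter, argument, value), and the sides `Pa j` of the target box as rational polynomials in the
parameters. [folklore] -/
structure SoloInformedTameMapShape (K : Type*) (n N : ℕ) where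
  /-- the families of pieces -/
  S : Fin N → Set (K ⊕ Fin n → ℝ)
  /-- the families of graphs of the moving maps -/
  G : Fin N → Set (K ⊕ (Fin n ⊕ Fin n) → ℝ)
  /-- the sides of the target box -/
  Pa : Fin n → MvPolynomial K ℚ

namespace SoloInformedTameMapShape

variable {K : Type*} {n N : ℕ} (σ : SoloInformedTameMapShape K n N)

/-- The sides `a(p)` of the target box at parameter `p`. [folklore] -/
def side (p : K → ℝ) : Fin n → ℝ := fun j => aeval p (σ.Pa j)

/-- The `i`-th piece at parameter `p`: the fibre `{x | (p, x) ∈ S i}`. [folklore] -/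
def piece (i : Fin N) (p : K → ℝ) : Set (Fin n → ℝ) := {x | Sum.elim p x ∈ σ.S i}

/-- The `i`-th moving relation at parameter `p`: `(x, y)` lies on the graph `G i(p)`. [folklore] -/
def rel (i : Fin N) (p : K → ℝ) (x y : Fin n → ℝ) : Prop := Sum.elim p (Sum.elim x y) ∈ σ.G i

section Clauses

/-! ### The derivative-free clauses, as sets of joint vectors -/

/-- PARTITION matrix in `(p, x)`: `x ∈ D₀ ↔ x` lies in some piece, and in at most one. [folklore] -/
def partSet (D₀ : Set (Fin n → ℝ)) : Set (K ⊕ Fin n → ℝ) :=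
  {w | (w ∘ Sum.inr ∈ D₀ ↔ ∃ i, w ∈ σ.S i) ∧ ∀ i i', i ≠ i' → w ∈ σ.S i → w ∉ σ.S i'}

/-- The graph family re-addressed to the block structure `(p, x) ⊕ y`. [folklore] -/
def graphPX (i : Fin N) : Set ((K ⊕ Fin n) ⊕ Fin n → ℝ) :=
  {w | w ∘ Sum.elim (Sum.inl ∘ Sum.inl) (Sum.elim (Sum.inl ∘ Sum.inr) Sum.inr) ∈ σ.G i}

/-- EXISTENCE matrix in `(p, x)`: if `x` lies in piece `i` then some `y` is related to it.
[folklore] -/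
def exSet (i : Fin N) : Set (K ⊕ Fin n → ℝ) :=
  {u | u ∈ σ.S i → ∃ y : Fin n → ℝ, Sum.elim u y ∈ σ.graphPX i}

/-- UNIQUENESS matrix in `(p, (x, y, y'))`: on piece `i` the relation is single-valued.
[folklore] -/
def uniqSet (i : Fin N) : Set (K ⊕ (Fin n ⊕ (Fin n ⊕ Fin n)) → ℝ) :=
  {w | w ∘ Sum.elim Sum.inl (Sum.inr ∘ Sum.inl) ∈ σ.S i →
    w ∘ Sum.elim Sum.inl (Sum.elim (Sum.inr ∘ Sum.inl) (Sum.inr ∘ Sum.inr ∘ Sum.inl)) ∈ σ.G i →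
    w ∘ Sum.elim Sum.inl (Sum.elim (Sum.inr ∘ Sum.inl) (Sum.inr ∘ Sum.inr ∘ Sum.inr)) ∈ σ.G i →
    ∀ j, w (Sum.inr (Sum.inr (Sum.inl j))) = w (Sum.inr (Sum.inr (Sum.inr j)))}

/-- INTO-THE-BOX matrix in `(p, (x, y))`: the image of piece `i` lies in the box. [folklore] -/
def intoSet (i : Fin N) : Set (K ⊕ (Fin n ⊕ Fin n) → ℝ) :=
  {w | w ∘ Sum.elim Sum.inl (Sum.inr ∘ Sum.inl) ∈ σ.S i → w ∈ σ.G i →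
    w ∘ (Sum.inr ∘ Sum.inr) ∈ soloInformedTameBox (σ.side (w ∘ Sum.inl))}

/-- ONTO-THE-BOX inner matrix in `((p, y), x)`: `x` lies in some piece and is related to `y`.
[folklore] -/
def ontoInner : Set ((K ⊕ Fin n) ⊕ Fin n → ℝ) :=
  {w | ∃ i, w ∘ Sum.elim (Sum.inl ∘ Sum.inl) Sum.inr ∈ σ.S i ∧
    w ∘ Sum.elim (Sum.inl ∘ Sum.inl) (Sum.elim Sum.inr (Sum.inl ∘ Sum.inr)) ∈ σ.G i}

/-- ONTO-THE-BOX matrix in `(p, y)`: a point of the box has a preimage in some piece. [folklore] -/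
def ontoSet : Set (K ⊕ Fin n → ℝ) :=
  {u | u ∘ Sum.inr ∈ soloInformedTameBox (σ.side (u ∘ Sum.inl)) →
    ∃ x : Fin n → ℝ, Sum.elim u x ∈ σ.ontoInner}

/-- INJECTIVITY matrix in `(p, (x, x', y))`: two points of pieces `i`, `i'` related to the same `y`
coincide, and `i = i'`. [folklore] -/
def injSet (i i' : Fin N) : Set (K ⊕ (Fin n ⊕ (Fin n ⊕ Fin n)) → ℝ) :=
  {w | w ∘ Sum.elim Sum.inl (Sum.inr ∘ Sum.inl) ∈ σ.S i →
    w ∘ Sum.elim Sum.inl (Sum.inr ∘ Sum.inr ∘ Sum.inl) ∈ σ.S i' →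
    w ∘ Sum.elim Sum.inl (Sum.elim (Sum.inr ∘ Sum.inl) (Sum.inr ∘ Sum.inr ∘ Sum.inr)) ∈ σ.G i →
    w ∘ Sum.elim Sum.inl (Sum.elim (Sum.inr ∘ Sum.inr ∘ Sum.inl) (Sum.inr ∘ Sum.inr ∘ Sum.inr))
      ∈ σ.G i' →
    i = i' ∧ ∀ j, w (Sum.inr (Sum.inl j)) = w (Sum.inr (Sum.inr (Sum.inl j)))}

/-! ### Their `ℚ`-semialgebraicity -/

variable {D₀ : Set (Fin n → ℝ)}

/-- The partition matrix is `ℚ`-semialgebraic. [cite: BochnakCosteRoy1998, §2.2] -/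
theorem isSemialgebraic_partSet (hS : ∀ i, IsSemialgebraic ℚ (σ.S i)) (hD₀ : IsSemialgebraic ℚ D₀) :
    IsSemialgebraic ℚ (σ.partSet D₀) := by
  unfold partSet
  refine soloInformed_isSemialgebraic_setOf_and
    (soloInformed_isSemialgebraic_setOf_iff (hD₀.preimage_comp Sum.inr)
      (soloInformed_isSemialgebraic_setOf_exists fun i => hS i)) ?_
  exact soloInformed_isSemialgebraic_setOf_forall fun i => soloInformed_isSemialgebraic_setOf_forall
    fun i' => soloInformed_isSemialgebraic_setOf_imp (soloInformed_isSemialgebraic_setOf_const _)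
      (soloInformed_isSemialgebraic_setOf_imp (hS i)
        (soloInformed_isSemialgebraic_setOf_not (hS i')))

/-- The re-addressed graph family is `ℚ`-semialgebraic. [cite: BochnakCosteRoy1998, §2.2] -/
theorem isSemialgebraic_graphPX {i : Fin N} (hG : IsSemialgebraic ℚ (σ.G i)) :
    IsSemialgebraic ℚ (σ.graphPX i) :=
  hG.preimage_comp _

/-- The existence matrix is `ℚ`-semialgebraic (one projection). [cite: BochnakCosteRoy1998, §2.2] -/
theorem isSemialgebraic_exSet [Finite K] {i : Fin N} (hS : IsSemialgebraic ℚ (σ.S i))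
    (hG : IsSemialgebraic ℚ (σ.G i)) : IsSemialgebraic ℚ (σ.exSet i) :=
  soloInformed_isSemialgebraic_setOf_imp hS
    (soloInformed_isSemialgebraic_setOf_exists_block (σ.isSemialgebraic_graphPX hG)
      fun _ => Iff.rfl)

/-- The uniqueness matrix is `ℚ`-semialgebraic. [cite: BochnakCosteRoy1998, §2.2] -/
theorem isSemialgebraic_uniqSet {i : Fin N} (hS : IsSemialgebraic ℚ (σ.S i))
    (hG : IsSemialgebraic ℚ (σ.G i)) : IsSemialgebraic ℚ (σ.uniqSet i) :=
  soloInformed_isSemialgebraic_setOf_imp (hS.preimage_comp _)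
    (soloInformed_isSemialgebraic_setOf_imp (hG.preimage_comp _)
      (soloInformed_isSemialgebraic_setOf_imp (hG.preimage_comp _)
        (soloInformed_isSemialgebraic_setOf_forall fun j =>
          soloInformed_isSemialgebraic_setOf_coord_eq _ (Sum.inr (Sum.inr (Sum.inr j))))))

/-- The into-the-box matrix is `ℚ`-semialgebraic. [cite: BochnakCosteRoy1998, §2.2] -/
theorem isSemialgebraic_intoSet {i : Fin N} (hS : IsSemialgebraic ℚ (σ.S i))
    (hG : IsSemialgebraic ℚ (σ.G i)) : IsSemialgebraic ℚ (σ.intoSet i) :=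
  soloInformed_isSemialgebraic_setOf_imp (hS.preimage_comp _)
    (soloInformed_isSemialgebraic_setOf_imp hG
      (soloInformed_isSemialgebraic_setOf_comp_mem_box _ _ _))

/-- The onto-the-box inner matrix is `ℚ`-semialgebraic. [cite: BochnakCosteRoy1998, §2.2] -/
theorem isSemialgebraic_ontoInner (hS : ∀ i, IsSemialgebraic ℚ (σ.S i))
    (hG : ∀ i, IsSemialgebraic ℚ (σ.G i)) : IsSemialgebraic ℚ σ.ontoInner :=
  soloInformed_isSemialgebraic_setOf_exists fun i =>
    soloInformed_isSemialgebraic_setOf_and ((hS i).preimage_comp _) ((hG i).preimage_comp _)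

/-- The onto-the-box matrix is `ℚ`-semialgebraic (one projection).
[cite: BochnakCosteRoy1998, §2.2] -/
theorem isSemialgebraic_ontoSet [Finite K] (hS : ∀ i, IsSemialgebraic ℚ (σ.S i))
    (hG : ∀ i, IsSemialgebraic ℚ (σ.G i)) : IsSemialgebraic ℚ σ.ontoSet :=
  soloInformed_isSemialgebraic_setOf_imp (soloInformed_isSemialgebraic_setOf_comp_mem_box _ _ _)
    (soloInformed_isSemialgebraic_setOf_exists_block (σ.isSemialgebraic_ontoInner hS hG)
      fun _ => Iff.rfl)

/-- The injectivity matrix is `ℚ`-semialgebraic. [cite: BochnakCosteRoy1998, §2.2] -/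
theorem isSemialgebraic_injSet {i i' : Fin N} (hS : ∀ i, IsSemialgebraic ℚ (σ.S i))
    (hG : ∀ i, IsSemialgebraic ℚ (σ.G i)) : IsSemialgebraic ℚ (σ.injSet i i') :=
  soloInformed_isSemialgebraic_setOf_imp ((hS i).preimage_comp _)
    (soloInformed_isSemialgebraic_setOf_imp ((hS i').preimage_comp _)
      (soloInformed_isSemialgebraic_setOf_imp ((hG i).preimage_comp _)
        (soloInformed_isSemialgebraic_setOf_imp ((hG i').preimage_comp _)
          (soloInformed_isSemialgebraic_setOf_and (soloInformed_isSemialgebraic_setOf_const _)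
            (soloInformed_isSemialgebraic_setOf_forall fun j =>
              soloInformed_isSemialgebraic_setOf_coord_eq _ (Sum.inr (Sum.inr (Sum.inl j))))))))

/-! ### The derivative-free part of validity and what it says -/

/-- **Basic validity** of the parameter `p` for the source `D₀` (everything except the derivative
clause): sides `≥ 0`; the pieces partition `D₀`; on each piece the relation is a function into the
box; every point of the box is reached; across and within pieces the maps are injective.
[folklore] -/
def BasicValid (D₀ : Set (Fin n → ℝ)) (p : K → ℝ) : Prop :=
  (∀ j, 0 ≤ σ.side p j) ∧
  (∀ x : Fin n → ℝ, Sum.elim p x ∈ σ.partSet D₀) ∧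
  (∀ i, ∀ x : Fin n → ℝ, Sum.elim p x ∈ σ.exSet i) ∧
  (∀ i, ∀ z : Fin n ⊕ (Fin n ⊕ Fin n) → ℝ, Sum.elim p z ∈ σ.uniqSet i) ∧
  (∀ i, ∀ z : Fin n ⊕ Fin n → ℝ, Sum.elim p z ∈ σ.intoSet i) ∧
  (∀ y : Fin n → ℝ, Sum.elim p y ∈ σ.ontoSet) ∧
  (∀ i i', ∀ z : Fin n ⊕ (Fin n ⊕ Fin n) → ℝ, Sum.elim p z ∈ σ.injSet i i')

/-- **Basic validity is `ℚ`-semialgebraic in the parameter.**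
[cite: BochnakCosteRoy1998, Prop. 2.2.4] -/
theorem isSemialgebraic_setOf_basicValid [Finite K] (hS : ∀ i, IsSemialgebraic ℚ (σ.S i))
    (hG : ∀ i, IsSemialgebraic ℚ (σ.G i)) (hD₀ : IsSemialgebraic ℚ D₀) :
    IsSemialgebraic ℚ {p : K → ℝ | σ.BasicValid D₀ p} := by
  unfold BasicValid
  refine soloInformed_isSemialgebraic_setOf_and
    (soloInformed_isSemialgebraic_setOf_forall fun j => ?_) ?_
  · simpa only [side] using isSemialgebraic_setOf_eval_nonneg (R := ℝ) (σ.Pa j)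
  refine soloInformed_isSemialgebraic_setOf_and
    (soloInformed_isSemialgebraic_setOf_forall_block (σ.isSemialgebraic_partSet hS hD₀)
      fun _ => Iff.rfl) ?_
  refine soloInformed_isSemialgebraic_setOf_and (soloInformed_isSemialgebraic_setOf_forall fun i =>
    soloInformed_isSemialgebraic_setOf_forall_block (σ.isSemialgebraic_exSet (hS i) (hG i))
      fun _ => Iff.rfl) ?_
  refine soloInformed_isSemialgebraic_setOf_and (soloInformed_isSemialgebraic_setOf_forall fun i =>
    soloInformed_isSemialgebraic_setOf_forall_block (σ.isSemialgebraic_uniqSet (hS i) (hG i))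
      fun _ => Iff.rfl) ?_
  refine soloInformed_isSemialgebraic_setOf_and (soloInformed_isSemialgebraic_setOf_forall fun i =>
    soloInformed_isSemialgebraic_setOf_forall_block (σ.isSemialgebraic_intoSet (hS i) (hG i))
      fun _ => Iff.rfl) ?_
  refine soloInformed_isSemialgebraic_setOf_and
    (soloInformed_isSemialgebraic_setOf_forall_block (σ.isSemialgebraic_ontoSet hS hG)
      fun _ => Iff.rfl) ?_
  exact soloInformed_isSemialgebraic_setOf_forall fun i =>
    soloInformed_isSemialgebraic_setOf_forall fun i' =>
      soloInformed_isSemialgebraic_setOf_forall_block (σ.isSemialgebraic_injSet hS hG)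
        fun _ => Iff.rfl

/-- **What basic validity says**, in terms of pieces, the relations and the sides. [folklore] -/
theorem basicValid_iff {D₀ : Set (Fin n → ℝ)} {p : K → ℝ} : σ.BasicValid D₀ p ↔
    (∀ j, 0 ≤ σ.side p j) ∧
    (∀ x, (x ∈ D₀ ↔ ∃ i, x ∈ σ.piece i p) ∧ ∀ i i', i ≠ i' → x ∈ σ.piece i p → x ∉ σ.piece i' p) ∧
    (∀ i x, x ∈ σ.piece i p → ∃ y, σ.rel i p x y) ∧
    (∀ i x y y', x ∈ σ.piece i p → σ.rel i p x y → σ.rel i p x y' → y = y') ∧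
    (∀ i x y, x ∈ σ.piece i p → σ.rel i p x y → y ∈ soloInformedTameBox (σ.side p)) ∧
    (∀ y, y ∈ soloInformedTameBox (σ.side p) → ∃ x, ∃ i, x ∈ σ.piece i p ∧ σ.rel i p x y) ∧
    (∀ i i' x x' y, x ∈ σ.piece i p → x' ∈ σ.piece i' p → σ.rel i p x y → σ.rel i' p x' y →
      i = i' ∧ x = x') := by
  have hPX : ∀ (x y : Fin n → ℝ), (Sum.elim (Sum.elim p x) y) ∘
      (Sum.elim (Sum.inl ∘ Sum.inl) (Sum.elim (Sum.inl ∘ Sum.inr) Sum.inr) :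
        K ⊕ (Fin n ⊕ Fin n) → (K ⊕ Fin n) ⊕ Fin n) = Sum.elim p (Sum.elim x y) := by
    intro x y; funext t; rcases t with l | j | j <;> rfl
  have h3a : ∀ z : Fin n ⊕ (Fin n ⊕ Fin n) → ℝ,
      (Sum.elim p z) ∘ (Sum.elim Sum.inl (Sum.inr ∘ Sum.inl) :
        K ⊕ Fin n → K ⊕ (Fin n ⊕ (Fin n ⊕ Fin n))) = Sum.elim p (fun j => z (Sum.inl j)) := by
    intro z; funext t; rcases t with l | j <;> rfl
  have h3b : ∀ z : Fin n ⊕ (Fin n ⊕ Fin n) → ℝ,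
      (Sum.elim p z) ∘ (Sum.elim Sum.inl (Sum.inr ∘ Sum.inr ∘ Sum.inl) :
        K ⊕ Fin n → K ⊕ (Fin n ⊕ (Fin n ⊕ Fin n))) =
        Sum.elim p (fun j => z (Sum.inr (Sum.inl j))) := by
    intro z; funext t; rcases t with l | j <;> rfl
  have h3c : ∀ z : Fin n ⊕ (Fin n ⊕ Fin n) → ℝ,
      (Sum.elim p z) ∘ (Sum.elim Sum.inl (Sum.elim (Sum.inr ∘ Sum.inl)
        (Sum.inr ∘ Sum.inr ∘ Sum.inl)) : K ⊕ (Fin n ⊕ Fin n) → K ⊕ (Fin n ⊕ (Fin n ⊕ Fin n)))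
        = Sum.elim p (Sum.elim (fun j => z (Sum.inl j)) (fun j => z (Sum.inr (Sum.inl j)))) := by
    intro z; funext t; rcases t with l | j | j <;> rfl
  have h3d : ∀ z : Fin n ⊕ (Fin n ⊕ Fin n) → ℝ,
      (Sum.elim p z) ∘ (Sum.elim Sum.inl (Sum.elim (Sum.inr ∘ Sum.inl)
        (Sum.inr ∘ Sum.inr ∘ Sum.inr)) : K ⊕ (Fin n ⊕ Fin n) → K ⊕ (Fin n ⊕ (Fin n ⊕ Fin n)))
        = Sum.elim p (Sum.elim (fun j => z (Sum.inl j)) (fun j => z (Sum.inr (Sum.inr j)))) := by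
    intro z; funext t; rcases t with l | j | j <;> rfl
  have h3e : ∀ z : Fin n ⊕ (Fin n ⊕ Fin n) → ℝ,
      (Sum.elim p z) ∘ (Sum.elim Sum.inl (Sum.elim (Sum.inr ∘ Sum.inr ∘ Sum.inl)
        (Sum.inr ∘ Sum.inr ∘ Sum.inr)) : K ⊕ (Fin n ⊕ Fin n) → K ⊕ (Fin n ⊕ (Fin n ⊕ Fin n)))
        = Sum.elim p (Sum.elim (fun j => z (Sum.inr (Sum.inl j)))
          (fun j => z (Sum.inr (Sum.inr j)))) := by
    intro z; funext t; rcases t with l | j | j <;> rfl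
  have h2a : ∀ z : Fin n ⊕ Fin n → ℝ,
      (Sum.elim p z) ∘ (Sum.elim Sum.inl (Sum.inr ∘ Sum.inl) : K ⊕ Fin n → K ⊕ (Fin n ⊕ Fin n))
        = Sum.elim p (fun j => z (Sum.inl j)) := by
    intro z; funext t; rcases t with l | j <;> rfl
  have h2b : ∀ z : Fin n ⊕ Fin n → ℝ,
      Sum.elim p z = Sum.elim p (Sum.elim (fun j => z (Sum.inl j)) (fun j => z (Sum.inr j))) := by
    intro z; funext t; rcases t with l | j | j <;> rfl
  have h2c : ∀ z : Fin n ⊕ Fin n → ℝ,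
      (Sum.elim p z) ∘ (Sum.inr ∘ Sum.inr : Fin n → K ⊕ (Fin n ⊕ Fin n)) =
        fun j => z (Sum.inr j) := by
    intro z; funext j; rfl
  have hO1 : ∀ (y x : Fin n → ℝ), (Sum.elim (Sum.elim p y) x) ∘
      (Sum.elim (Sum.inl ∘ Sum.inl) Sum.inr : K ⊕ Fin n → (K ⊕ Fin n) ⊕ Fin n) = Sum.elim p x := by
    intro y x; funext t; rcases t with l | j <;> rfl
  have hO2 : ∀ (y x : Fin n → ℝ), (Sum.elim (Sum.elim p y) x) ∘
      (Sum.elim (Sum.inl ∘ Sum.inl) (Sum.elim Sum.inr (Sum.inl ∘ Sum.inr)) :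
        K ⊕ (Fin n ⊕ Fin n) → (K ⊕ Fin n) ⊕ Fin n) = Sum.elim p (Sum.elim x y) := by
    intro y x; funext t; rcases t with l | j | j <;> rfl
  simp only [BasicValid, partSet, exSet, graphPX, uniqSet, intoSet, ontoSet, ontoInner, injSet,
    piece, rel, mem_setOf_eq, Sum.elim_comp_inr, Sum.elim_comp_inl, Sum.elim_inr, hPX, h3a, h3b,
    h3c, h3d, h3e, h2a, h2c, hO1, hO2]
  refine and_congr Iff.rfl (and_congr Iff.rfl (and_congr Iff.rfl (and_congr ?_ (and_congr ?_
    (and_congr Iff.rfl ?_)))))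
  · refine forall_congr' fun i => ⟨fun h x y y' hx hy hy' => ?_, fun h z hx hy hy' => ?_⟩
    · have := h (Sum.elim x (Sum.elim y y')) (by simpa using hx) (by simpa using hy)
        (by simpa using hy')
      funext j
      simpa using this j
    · exact fun j => congr_fun (h _ _ _ hx hy hy') j
  · refine forall_congr' fun i => ⟨fun h x y hx hy => ?_, fun h z hx hy => ?_⟩
    · have := h (Sum.elim x y) (by simpa using hx) (by simpa [← h2b] using hy)
      simpa using this
    · have := h _ _ hx (by rw [← h2b]; exact hy)
      simpa using this
  · refine forall_congr' fun i => forall_congr' fun i' => ⟨fun h x x' y hx hx' hy hy' => ?_,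
      fun h z hx hx' hy hy' => ?_⟩
    · have := h (Sum.elim x (Sum.elim x' y)) (by simpa using hx) (by simpa using hx')
        (by simpa using hy) (by simpa using hy')
      exact ⟨this.1, funext fun j => by simpa using this.2 j⟩
    · have := h _ _ _ hx hx' hy hy'
      exact ⟨this.1, fun j => congr_fun this.2 j⟩

end Clauses

end SoloInformedTameMapShape

end Summit.KontsevichZagierPeriods.KontsevichZagierPeriods.Theorems
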